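import Mathlib.Algebra.GroupWithZero.Basic
import Mathlib.Algebra.GroupWithZero.Units.Basic
import Mathlib.Data.Fintype.BigOperators
import Literature.Computability.AlgebraicComplexity.LRPencilOfMatrix
import Literature.Computability.AlgebraicComplexity.GrenetEquivariant

/-!
# Crux `RigidMinimalReps.MinimalRepTorusSymmetric` (stmt-ValiantsHypothesis-5112), line `birth` —
# stub `stub_tightLifts` (a tight affine matrix has DIAGONAL exact lifts of the two-sided torus)

Setting: an `s × s` matrix `A` of affine polynomials in the `n²` variables `x_{kl}` (`(A i j).totalDegree ≤ 1`),
with row/column potentials `α, β : Fin s → M`, `M = (Fin n → ℤ) × (Fin n → ℤ)` the character lattice of the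
two-sided torus `T = (ℂˣ)ⁿ × (ℂˣ)ⁿ`, which are TIGHT: a constant of `A` only sits where `α i + β j = 0` and the
variable `x_{kl}` only where `α i + β j = (e_k, e_l)`.  Conclusion: for all nonvanishing `d, e : Fin n → ℂ` the torus
substitution `x_{kl} ↦ d_k e_l x_{kl}` lifts exactly to a DIAGONAL gauge pair,
`A(d_k e_l x_{kl}) = P · A · Q` with `P = diag(χ_{α i}(d,e))`, `Q = diag(χ_{β j}(d,e))`, where
`χ_{(a,b)}(d,e) = ∏_k d_k^{a_k} · ∏_l e_l^{b_l}` is the Laurent character of `T` attached to `(a, b) ∈ M`.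

Proof.  `χ` is multiplicative (`χ_{a+b} = χ_a χ_b`, `χ_0 = 1`), nonvanishing, and `χ_{(e_k,e_l)} = d_k e_l`.  Write
each entry affinely, `A i j = C c₀ + ∑_v C c_v · X v` (`LRPencil.eq_affine_of_totalDegree_le_one`).  The diagonal
substitution fixes constants and scales `X v` by `d_{v.1} e_{v.2}` (`Grenet.linSubst_diagonal_X`); the gauge pair
multiplies the entry by `χ_{α i} χ_{β j} = χ_{α i + β j}`, which is `χ_0 = 1` wherever `c₀ ≠ 0` and
`χ_{(e_{v.1}, e_{v.2})} = d_{v.1} e_{v.2}` wherever `c_v ≠ 0` — so both sides agree summand by summand.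
No determinant hypothesis is used.
[cite: LandsbergRessayre2017, Def. 1.3]
-/

-- Sub = Summit single-conjunct layout: the duplicated namespace component is mandated by the tree.
set_option linter.dupNamespace false

noncomputable section

namespace Summit.ValiantsHypothesis.ValiantsHypothesis.Theorems.RigidMinimalRepsMinimalRepTorusSymmetric

open Matrix MvPolynomial Finset
open Literature.Computability.AlgebraicComplexity LRPencil

/-! ### The Laurent characters of the two-sided torus -/

section Character

variable {n : ℕ}

/-- The Laurent character `χ_m(d,e) = ∏_k d_k^{m.1 k} · ∏_l e_l^{m.2 l}` is multiplicative in `m`: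
`χ_{a+b} = χ_a · χ_b` for nonvanishing `d, e`. [folklore] -/
theorem char_add (d e : Fin n → ℂ) (hd : ∀ k, d k ≠ 0) (he : ∀ l, e l ≠ 0)
    (a b : (Fin n → ℤ) × (Fin n → ℤ)) :
    (∏ k, d k ^ ((a + b).1 k)) * ∏ l, e l ^ ((a + b).2 l) =
      ((∏ k, d k ^ (a.1 k)) * ∏ l, e l ^ (a.2 l)) * ((∏ k, d k ^ (b.1 k)) * ∏ l, e l ^ (b.2 l)) := by
  simp only [Prod.fst_add, Prod.snd_add, Pi.add_apply, zpow_add₀ (hd _), zpow_add₀ (he _),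
    prod_mul_distrib]
  ring

/-- The trivial character: `χ_0(d,e) = 1`. [folklore] -/
theorem char_zero (d e : Fin n → ℂ) :
    (∏ k, d k ^ ((0 : (Fin n → ℤ) × (Fin n → ℤ)).1 k)) *
        ∏ l, e l ^ ((0 : (Fin n → ℤ) × (Fin n → ℤ)).2 l) = 1 := by
  simp

/-- The character of the variable `x_{kl}`: `χ_{(e_k, e_l)}(d,e) = d_k · e_l`. [folklore] -/
theorem char_single (d e : Fin n → ℂ) (k l : Fin n) :
    (∏ k', d k' ^ (Pi.single k 1 : Fin n → ℤ) k') * ∏ l', e l' ^ (Pi.single l 1 : Fin n → ℤ) l' =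
      d k * e l := by
  have h1 : ∏ k', d k' ^ (Pi.single k 1 : Fin n → ℤ) k' = d k := by
    rw [Fintype.prod_eq_single k fun k' hk' => by rw [Pi.single_eq_of_ne hk', zpow_zero]]
    rw [Pi.single_eq_same, zpow_one]
  have h2 : ∏ l', e l' ^ (Pi.single l 1 : Fin n → ℤ) l' = e l := by
    rw [Fintype.prod_eq_single l fun l' hl' => by rw [Pi.single_eq_of_ne hl', zpow_zero]]
    rw [Pi.single_eq_same, zpow_one]
  rw [h1, h2]

/-- The Laurent characters do not vanish on the torus. [folklore] -/
theorem char_ne_zero (d e : Fin n → ℂ) (hd : ∀ k, d k ≠ 0) (he : ∀ l, e l ≠ 0)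
    (m : (Fin n → ℤ) × (Fin n → ℤ)) :
    (∏ k, d k ^ (m.1 k)) * ∏ l, e l ^ (m.2 l) ≠ 0 :=
  mul_ne_zero (prod_ne_zero_iff.2 fun k _ => zpow_ne_zero _ (hd k))
    (prod_ne_zero_iff.2 fun l _ => zpow_ne_zero _ (he l))

end Character

/-! ### One entry: a diagonal substitution on a tight affine polynomial -/

section Entry

variable {σ : Type*} [Fintype σ] [DecidableEq σ]

/-- **Entrywise form of the lift.**  If `p` is affine, `a · b = 1` whenever `p` has a constant term and
`a · b = c v` whenever `x_v` occurs in `p`, then the diagonal substitution `x_v ↦ c_v x_v` acts on `p` as the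
two-sided scaling `p ↦ C a · p · C b`. [folklore] -/
theorem linSubst_diagonal_eq_C_mul_mul_C (p : MvPolynomial σ ℂ) (hp : p.totalDegree ≤ 1) (c : σ → ℂ)
    (a b : ℂ) (h0 : coeff 0 p ≠ 0 → a * b = 1)
    (h1 : ∀ v, coeff (Finsupp.single v 1) p ≠ 0 → a * b = c v) :
    linSubst σ ℂ (Matrix.diagonal c) p = C a * p * C b := by
  -- one summand: `C q · (t • r) = C a · (C q · r) · C b` as soon as `q ≠ 0 ⇒ a b = t`
  have key : ∀ (q t : ℂ) (r : MvPolynomial σ ℂ), (q ≠ 0 → a * b = t) →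
      C q * (t • r) = C a * (C q * r) * C b := by
    intro q t r hq
    by_cases h : q = 0
    · simp [h]
    · rw [smul_eq_C_mul, ← hq h, map_mul]
      ring
  rw [eq_affine_of_totalDegree_le_one p hp]
  rw [map_add, map_sum, mul_add, add_mul, Finset.mul_sum, Finset.sum_mul, linSubst_C]
  congr 1
  · simpa only [one_smul, mul_one] using key (coeff 0 p) 1 1 h0
  · refine Finset.sum_congr rfl fun v _ => ?_
    rw [map_mul, linSubst_C, Grenet.linSubst_diagonal_X]
    exact key _ _ _ (h1 v)

end Entry

/-! ### The stub -/

/-- **Registered stub `stub_tightLifts`** of line `birth` of crux `MinimalRepTorusSymmetric`: a tight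
(`T`-bigraded) affine matrix has DIAGONAL exact lifts of every two-sided torus element.  If every constant
of `A` sits where `α i + β j = 0` and every occurrence of `x_{kl}` where `α i + β j = (e_k, e_l)`, then for all
nonvanishing `d, e : Fin n → ℂ`, `A(d_k e_l x_{kl}) = P · A · Q` with `P = diag(χ_{α i}(d,e))`,
`Q = diag(χ_{β j}(d,e))`, `χ_{(a,b)}(d,e) = ∏_k d_k^{a_k} · ∏_l e_l^{b_l}`. [cite: LandsbergRessayre2017, Def. 1.3] -/
theorem stub_tightLifts :
    ∀ (n s : ℕ) (A : Matrix (Fin s) (Fin s) (MvPolynomial (Fin n × Fin n) ℂ))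
    (α β : Fin s → (Fin n → ℤ) × (Fin n → ℤ)),
    (∀ i j, (A i j).totalDegree ≤ 1) →
    (∀ i j, constPart A i j ≠ 0 → α i + β j = 0) →
    (∀ i j (v : Fin n × Fin n), coeffMat A v i j ≠ 0 →
      α i + β j = ((Pi.single v.1 1 : Fin n → ℤ), (Pi.single v.2 1 : Fin n → ℤ))) →
    ∀ (d e : Fin n → ℂ), (∀ k, d k ≠ 0) → (∀ l, e l ≠ 0) →
      ∃ P Q : GL (Fin s) ℂ,
        A.map (linSubst (Fin n × Fin n) ℂ (Matrix.diagonal fun p => d p.1 * e p.2)) =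
          (P : Matrix (Fin s) (Fin s) ℂ).map C * A * (Q : Matrix (Fin s) (Fin s) ℂ).map C := by
  intro n s A α β hdeg hconst hcoeff d e hd he
  -- the Laurent character `χ_m(d,e) = ∏_k d_k^{m.1 k} · ∏_l e_l^{m.2 l}`
  set χ : (Fin n → ℤ) × (Fin n → ℤ) → ℂ := fun m => (∏ k, d k ^ (m.1 k)) * ∏ l, e l ^ (m.2 l)
  have hχne : ∀ m, χ m ≠ 0 := fun m => char_ne_zero d e hd he m
  have hχadd : ∀ a b, χ (a + b) = χ a * χ b := fun a b => char_add d e hd he a b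
  refine ⟨diagUnit ℂ (fun i => χ (α i)) (fun i => hχne _), diagUnit ℂ (fun j => χ (β j)) (fun j => hχne _), ?_⟩
  refine Matrix.ext fun i j => ?_
  rw [coe_diagUnit, coe_diagUnit, Matrix.diagonal_map C_0, Matrix.diagonal_map C_0, Matrix.mul_diagonal,
    Matrix.diagonal_mul, Matrix.map_apply]
  refine linSubst_diagonal_eq_C_mul_mul_C (A i j) (hdeg i j) _ _ _ (fun h0 => ?_) (fun v hv => ?_)
  · -- constant term present: `χ_{α i} χ_{β j} = χ_{α i + β j} = χ_0 = 1`
    have h0' : constPart A i j ≠ 0 := by rwa [constPart_apply, constantCoeff_eq]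
    rw [← hχadd, hconst i j h0']
    exact char_zero d e
  · -- `x_v` present: `χ_{α i} χ_{β j} = χ_{(e_{v.1}, e_{v.2})} = d_{v.1} e_{v.2}`
    have hv' : coeffMat A v i j ≠ 0 := by rwa [coeffMat_apply]
    rw [← hχadd, hcoeff i j v hv']
    exact char_single d e v.1 v.2

end Summit.ValiantsHypothesis.ValiantsHypothesis.Theorems.RigidMinimalRepsMinimalRepTorusSymmetric

end
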